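import Mathlib

/-! drefute gen 3 — Lean route for `stub_cone_of_discSections`, part A: algebra of the central-difference
nodes (nodal weights of equally spaced nodes; partial fractions). -/

noncomputable section

namespace DrefuteG3

open Finset Polynomial

/-- `∏_{i < m} (m - i) = m!` in a commutative ring. -/
theorem prod_range_sub_nat_cast (R : Type*) [CommRing R] (m : ℕ) :
    ∏ i ∈ range m, ((m : R) - i) = (m.factorial : R) := by
  induction m with
  | zero => simp
  | succ m ih =>
    rw [Finset.prod_range_succ', Nat.factorial_succ, Nat.cast_mul]
    have : ∀ i ∈ range m, ((m + 1 : ℕ) : R) - ((i + 1 : ℕ) : R) = (m : R) - i := by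
      intro i _; push_cast; ring
    rw [Finset.prod_congr rfl this, ih]
    push_cast
    ring

/-- `∏_{m < i ≤ n} (m - i) = (-1)^{n-m} (n-m)!`. -/
theorem prod_Ioc_sub_nat_cast (R : Type*) [CommRing R] {m n : ℕ} (hmn : m ≤ n) :
    ∏ i ∈ Ioc m n, ((m : R) - i) = (-1) ^ (n - m) * ((n - m).factorial : R) := by
  obtain ⟨d, rfl⟩ := Nat.exists_eq_add_of_le hmn
  simp only [add_tsub_cancel_left]
  induction d with
  | zero => simp
  | succ d ih =>
    rw [← add_assoc, Finset.prod_Ioc_succ_top (by omega), ih (by omega), Nat.factorial_succ]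
    push_cast
    ring

/-- The erased range splits as `[0, m) ∪ (m, n]`. -/
theorem range_succ_erase_eq (m n : ℕ) (hmn : m ≤ n) :
    (range (n + 1)).erase m = range m ∪ Ioc m n := by
  ext i
  simp only [mem_erase, mem_range, mem_union, mem_Ioc]
  omega

/-- **Nodal product of equally spaced integer nodes**: `∏_{i ≤ n, i ≠ m} (m - i) = (-1)^{n-m} m! (n-m)!`. -/
theorem prod_erase_sub_nat_cast (R : Type*) [CommRing R] {m n : ℕ} (hmn : m ≤ n) :
    ∏ i ∈ (range (n + 1)).erase m, ((m : R) - i) =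
      (-1) ^ (n - m) * (m.factorial : R) * ((n - m).factorial : R) := by
  rw [range_succ_erase_eq m n hmn, Finset.prod_union, prod_range_sub_nat_cast, prod_Ioc_sub_nat_cast R hmn]
  · ring
  · rw [Finset.disjoint_left]
    intro i hi hi'
    simp only [mem_range] at hi
    simp only [mem_Ioc] at hi'
    omega

/-- The central-difference nodes `v_m = (m - k) h`, `m = 0, …, 2k`, as real numbers cast to `ℂ`. -/
def node (k : ℕ) (h : ℝ) (m : ℕ) : ℂ := ((((m : ℝ) - k) * h : ℝ) : ℂ)

theorem node_eq (k : ℕ) (h : ℝ) (m : ℕ) : node k h m = ((m : ℂ) - k) * h := by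
  simp [node]

theorem node_sub_node (k : ℕ) (h : ℝ) (m i : ℕ) : node k h m - node k h i = ((m : ℂ) - i) * h := by
  simp only [node_eq]; ring

theorem node_injOn (k : ℕ) {h : ℝ} (hh : h ≠ 0) : Set.InjOn (node k h) (range (2 * k + 1) : Set ℕ) := by
  intro m _ i _ hmi
  have h1 : ((m : ℂ) - i) * h = 0 := by rw [← node_sub_node, hmi, sub_self]
  rcases mul_eq_zero.1 h1 with h2 | h2
  · exact_mod_cast sub_eq_zero.1 h2
  · exact absurd (by exact_mod_cast h2) hh

theorem norm_node_le (k : ℕ) {h : ℝ} (hh : 0 ≤ h) {m : ℕ} (hm : m ∈ range (2 * k + 1)) :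
    ‖node k h m‖ ≤ k * h := by
  rw [node, Complex.norm_real, Real.norm_eq_abs, abs_mul, abs_of_nonneg hh]
  refine mul_le_mul_of_nonneg_right ?_ hh
  rw [mem_range] at hm
  rw [abs_le]
  constructor
  · have : (0 : ℝ) ≤ m := Nat.cast_nonneg m
    linarith
  · have : (m : ℝ) ≤ 2 * k := by exact_mod_cast (by omega : m ≤ 2 * k)
    linarith

/-- **Nodal weights of the central-difference nodes**:
`(2k)! h^{2k} ∏_{i ≠ m} (v_m - v_i)⁻¹ = (-1)^m C(2k, m)`. -/
theorem nodalWeight_node (k : ℕ) {h : ℝ} (hh : h ≠ 0) {m : ℕ} (hm : m ∈ range (2 * k + 1)) :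
    ((2 * k).factorial : ℂ) * (h : ℂ) ^ (2 * k) * Lagrange.nodalWeight (range (2 * k + 1)) (node k h) m =
      (-1) ^ m * ((2 * k).choose m : ℂ) := by
  have hm' : m ≤ 2 * k := by rw [mem_range] at hm; omega
  rw [Lagrange.nodalWeight, Finset.prod_inv_distrib]
  simp_rw [node_sub_node]
  rw [Finset.prod_mul_distrib, Finset.prod_const, Finset.card_erase_of_mem hm, Finset.card_range,
    Nat.add_sub_cancel, prod_erase_sub_nat_cast ℂ hm']
  have hfac : ((2 * k).choose m : ℂ) * (m.factorial : ℂ) * ((2 * k - m).factorial : ℂ) =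
      ((2 * k).factorial : ℂ) := by
    exact_mod_cast Nat.choose_mul_factorial_mul_factorial hm'
  have hm0 : (m.factorial : ℂ) ≠ 0 := by exact_mod_cast (Nat.factorial_pos m).ne'
  have hnm0 : ((2 * k - m).factorial : ℂ) ≠ 0 := by exact_mod_cast (Nat.factorial_pos _).ne'
  have hh0 : (h : ℂ) ^ (2 * k) ≠ 0 := pow_ne_zero _ (by exact_mod_cast hh)
  have hsign : ((-1 : ℂ) ^ (2 * k - m)) = (-1) ^ m := by
    have : (-1 : ℂ) ^ (2 * k - m) * (-1) ^ m = 1 := by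
      rw [← pow_add, Nat.sub_add_cancel hm', pow_mul]; simp
    have h2 : ((-1 : ℂ) ^ m) * (-1) ^ m = 1 := by rw [← pow_add, ← two_mul, pow_mul]; simp
    calc ((-1 : ℂ) ^ (2 * k - m)) = (-1) ^ (2 * k - m) * ((-1) ^ m * (-1) ^ m) := by rw [h2, mul_one]
      _ = ((-1) ^ (2 * k - m) * (-1) ^ m) * (-1) ^ m := by ring
      _ = (-1) ^ m := by rw [this, one_mul]
  rw [hsign, ← hfac]
  have h2 : ((-1 : ℂ) ^ m) * (-1) ^ m = 1 := by rw [← pow_add, ← two_mul, pow_mul]; simp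
  have hQ : ((-1 : ℂ) ^ m * (m.factorial : ℂ) * ((2 * k - m).factorial : ℂ)) * (h : ℂ) ^ (2 * k) ≠ 0 := by
    refine mul_ne_zero (mul_ne_zero (mul_ne_zero ?_ hm0) hnm0) hh0
    exact pow_ne_zero _ (by norm_num)
  rw [← div_eq_mul_inv, div_eq_iff hQ]
  linear_combination (-(((2 * k).choose m : ℂ) * (m.factorial : ℂ) * ((2 * k - m).factorial : ℂ) *
    (h : ℂ) ^ (2 * k))) * h2

/-- **Partial fractions for the central difference**: off the nodes,
`∑_m (-1)^m C(2k,m) (z - v_m)⁻¹ = (2k)! h^{2k} (∏_m (z - v_m))⁻¹`. -/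
theorem sum_centralCoeff_mul_inv (k : ℕ) {h : ℝ} (hh : h ≠ 0) {z : ℂ}
    (hz : ∀ m ∈ range (2 * k + 1), z ≠ node k h m) :
    ∑ m ∈ range (2 * k + 1), (-1) ^ m * ((2 * k).choose m : ℂ) * (z - node k h m)⁻¹ =
      ((2 * k).factorial : ℂ) * (h : ℂ) ^ (2 * k) * (∏ m ∈ range (2 * k + 1), (z - node k h m))⁻¹ := by
  set s : Finset ℕ := range (2 * k + 1) with hs
  have hsne : s.Nonempty := ⟨0, by simp [hs]⟩
  have hvs := node_injOn k hh
  -- Lagrange: `eval z (nodal s v) * ∑ w_m (z - v_m)⁻¹ = 1`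
  have key : eval z (Lagrange.nodal s (node k h)) *
      ∑ m ∈ s, Lagrange.nodalWeight s (node k h) m * (z - node k h m)⁻¹ = 1 := by
    have h1 := Lagrange.eval_interpolate_not_at_node (1 : ℕ → ℂ) hz
    rw [Lagrange.interpolate_one hvs hsne, eval_one] at h1
    simpa only [Pi.one_apply, mul_one] using h1.symm
  rw [Lagrange.eval_nodal] at key
  have hprod : (∏ m ∈ s, (z - node k h m)) ≠ 0 :=
    Finset.prod_ne_zero_iff.2 fun m hm => sub_ne_zero.2 (hz m hm)
  have hsum : ∑ m ∈ s, Lagrange.nodalWeight s (node k h) m * (z - node k h m)⁻¹ =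
      (∏ m ∈ s, (z - node k h m))⁻¹ := by
    exact eq_inv_of_mul_eq_one_right key
  rw [← hsum, Finset.mul_sum]
  refine Finset.sum_congr rfl fun m hm => ?_
  rw [← nodalWeight_node k hh hm]
  ring


/-! ## Part B: the central difference of a bounded holomorphic function on a disc (contour bound) -/

section Contour

open Complex Metric Real

/-- The central difference `Δ_h^{2k} f(0) = ∑_m (-1)^m C(2k,m) f((m-k)h)`. -/
def centralDiff (k : ℕ) (h : ℝ) (f : ℂ → ℂ) : ℂ :=
  ∑ m ∈ range (2 * k + 1), (-1) ^ m * ((2 * k).choose m : ℂ) * f (node k h m)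

/-- **Contour bound for central differences.** If `f` is holomorphic on the disc `|z| < t` and bounded
by `M` there, then for `0 < h`, `k h < r < t`:
`‖Δ_h^{2k} f(0)‖ ≤ (2k)! h^{2k} · M r / (r - kh)^{2k+1}` (Cauchy's formula at the `2k+1` nodes, partial
fractions, and `|z - v_m| ≥ r - kh` on `|z| = r`). -/
theorem norm_centralDiff_le (k : ℕ) {f : ℂ → ℂ} {t r h M : ℝ}
    (hf : DifferentiableOn ℂ f (ball (0 : ℂ) t)) (hM : ∀ z ∈ ball (0 : ℂ) t, ‖f z‖ ≤ M)
    (hh : 0 < h) (hkr : k * h < r) (hrt : r < t) :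
    ‖centralDiff k h f‖ ≤ (2 * k).factorial * h ^ (2 * k) * (r * (M / (r - k * h) ^ (2 * k + 1))) := by
  have hkh : (0 : ℝ) ≤ k * h := by positivity
  have hr : 0 < r := lt_of_le_of_lt hkh hkr
  have hnode : ∀ m ∈ range (2 * k + 1), node k h m ∈ ball (0 : ℂ) r := fun m hm => by
    rw [Metric.mem_ball, dist_zero_right]
    exact lt_of_le_of_lt (norm_node_le k hh.le hm) hkr
  have hdc : DiffContOnCl ℂ f (ball (0 : ℂ) r) := by
    refine DifferentiableOn.diffContOnCl ?_
    rw [closure_ball (0 : ℂ) hr.ne']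
    exact hf.mono (Metric.closedBall_subset_ball hrt)
  -- Cauchy's formula at each node
  have hC : ∀ m ∈ range (2 * k + 1),
      f (node k h m) = (2 * π * I : ℂ)⁻¹ * ∮ z in C(0, r), (z - node k h m)⁻¹ * f z := by
    intro m hm
    have := hdc.two_pi_i_inv_smul_circleIntegral_sub_inv_smul (hnode m hm)
    simpa only [smul_eq_mul] using this.symm
  -- points of the circle are off the nodes, at distance ≥ r - kh
  have hdist : ∀ z ∈ sphere (0 : ℂ) r, ∀ m ∈ range (2 * k + 1), r - k * h ≤ ‖z - node k h m‖ := by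
    intro z hz m hm
    rw [mem_sphere_zero_iff_norm] at hz
    have h1 := norm_node_le k hh.le hm
    have h2 : ‖z‖ - ‖node k h m‖ ≤ ‖z - node k h m‖ := norm_sub_norm_le z _
    linarith
  have hoff : ∀ z ∈ sphere (0 : ℂ) r, ∀ m ∈ range (2 * k + 1), z ≠ node k h m := by
    intro z hz m hm heq
    have := hdist z hz m hm
    rw [heq, sub_self, norm_zero] at this
    linarith
  -- rewrite the central difference as one contour integral
  set g : ℂ → ℂ := fun z => (∑ m ∈ range (2 * k + 1),
      (-1) ^ m * ((2 * k).choose m : ℂ) * (z - node k h m)⁻¹) * f z with hg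
  have hterm_int : ∀ m ∈ range (2 * k + 1),
      CircleIntegrable (fun z => (-1) ^ m * ((2 * k).choose m : ℂ) * ((z - node k h m)⁻¹ * f z)) 0 r := by
    intro m hm
    refine ContinuousOn.circleIntegrable hr.le ?_
    refine ContinuousOn.mul continuousOn_const (ContinuousOn.mul ?_ ?_)
    · refine ContinuousOn.inv₀ (by fun_prop) fun z hz => sub_ne_zero.2 (hoff z hz m hm)
    · refine hdc.continuousOn.mono ?_
      rw [closure_ball (0 : ℂ) hr.ne']
      exact sphere_subset_closedBall
  have hsum_eq : centralDiff k h f = (2 * π * I : ℂ)⁻¹ * ∮ z in C(0, r), g z := by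
    have e1 : (∮ z in C(0, r), g z) = ∑ m ∈ range (2 * k + 1),
        ∮ z in C(0, r), (-1) ^ m * ((2 * k).choose m : ℂ) * ((z - node k h m)⁻¹ * f z) := by
      rw [← circleIntegral.integral_fun_sum hterm_int]
      refine circleIntegral.integral_congr hr.le fun z _ => ?_
      simp only [hg, Finset.sum_mul]
      refine Finset.sum_congr rfl fun m _ => ?_
      ring
    rw [e1, Finset.mul_sum, centralDiff]
    refine Finset.sum_congr rfl fun m hm => ?_
    rw [circleIntegral.integral_const_mul, hC m hm]
    ring
  -- bound the integrand on the circle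
  have hbound : ∀ z ∈ sphere (0 : ℂ) r,
      ‖g z‖ ≤ (2 * k).factorial * h ^ (2 * k) * (M / (r - k * h) ^ (2 * k + 1)) := by
    intro z hz
    have hzt : z ∈ ball (0 : ℂ) t := by
      rw [Metric.mem_ball, dist_zero_right]; rw [mem_sphere_zero_iff_norm] at hz; linarith
    simp only [hg]
    rw [sum_centralCoeff_mul_inv k hh.ne' (hoff z hz), norm_mul, norm_mul, norm_mul, norm_inv,
      Complex.norm_natCast, norm_pow, Complex.norm_real, Real.norm_eq_abs, abs_of_pos hh, norm_prod]
    have hprod : (r - k * h) ^ (2 * k + 1) ≤ ∏ m ∈ range (2 * k + 1), ‖z - node k h m‖ := by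
      calc (r - k * h) ^ (2 * k + 1) = ∏ _m ∈ range (2 * k + 1), (r - k * h) := by
            rw [Finset.prod_const, Finset.card_range]
        _ ≤ ∏ m ∈ range (2 * k + 1), ‖z - node k h m‖ :=
            Finset.prod_le_prod (fun _ _ => by linarith) fun m hm => hdist z hz m hm
    have hpos : 0 < (r - k * h) ^ (2 * k + 1) := pow_pos (by linarith) _
    have h1 : (∏ m ∈ range (2 * k + 1), ‖z - node k h m‖)⁻¹ * ‖f z‖ ≤ ((r - k * h) ^ (2 * k + 1))⁻¹ * M :=
      mul_le_mul (inv_anti₀ hpos hprod) (hM z hzt) (norm_nonneg _)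
        (inv_nonneg.2 (pow_nonneg (by linarith) _))
    calc ((2 * k).factorial : ℝ) * h ^ (2 * k) * (∏ m ∈ range (2 * k + 1), ‖z - node k h m‖)⁻¹ * ‖f z‖
        = ((2 * k).factorial * h ^ (2 * k)) * ((∏ m ∈ range (2 * k + 1), ‖z - node k h m‖)⁻¹ * ‖f z‖) := by
          ring
      _ ≤ ((2 * k).factorial * h ^ (2 * k)) * (((r - k * h) ^ (2 * k + 1))⁻¹ * M) :=
          mul_le_mul_of_nonneg_left h1 (by positivity)
      _ = (2 * k).factorial * h ^ (2 * k) * (M / (r - k * h) ^ (2 * k + 1)) := by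
          rw [div_eq_mul_inv]; ring
  rw [hsum_eq]
  have := circleIntegral.norm_two_pi_i_inv_smul_integral_le_of_norm_le_const hr.le hbound
  rw [smul_eq_mul] at this
  calc ‖(2 * π * I : ℂ)⁻¹ * ∮ z in C(0, r), g z‖
      ≤ r * ((2 * k).factorial * h ^ (2 * k) * (M / (r - k * h) ^ (2 * k + 1))) := this
    _ = (2 * k).factorial * h ^ (2 * k) * (r * (M / (r - k * h) ^ (2 * k + 1))) := by ring

end Contour


/-! ## Part C: the trigonometric identity and the integral identity -/

section Trig

open Complex

/-- `e^{iw} - e^{-iw} = 2 sin(w) i`. -/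
theorem cexp_sub_cexp_neg (w : ℂ) : cexp (w * I) - cexp (-(w * I)) = 2 * (Complex.sin w * I) := by
  rw [← Complex.sinh_mul_I, Complex.sinh]
  ring

/-- **The trigonometric identity behind the central difference**:
`∑_m (-1)^m C(2k,m) e^{i(m-k)x} = (-1)^k (2 sin(x/2))^{2k}` for real `x`. -/
theorem sum_centralCoeff_cexp (k : ℕ) (x : ℝ) :
    ∑ m ∈ range (2 * k + 1), (-1) ^ m * ((2 * k).choose m : ℂ) * cexp (((((m : ℝ) - k) * x : ℝ)) * I) =
      (-1) ^ k * (((2 * Real.sin (x / 2)) ^ (2 * k) : ℝ) : ℂ) := by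
  set w : ℂ := ((x / 2 : ℝ) : ℂ) with hw
  set a : ℂ := cexp (w * I) with ha
  set b : ℂ := cexp (-(w * I)) with hb
  -- each term is a binomial term of `(a + (-b))^{2k}`
  have hterm : ∀ m ∈ range (2 * k + 1),
      (-1) ^ m * ((2 * k).choose m : ℂ) * cexp (((((m : ℝ) - k) * x : ℝ)) * I) =
        a ^ m * (-b) ^ (2 * k - m) * ((2 * k).choose m : ℂ) := by
    intro m hm
    have hm' : m ≤ 2 * k := by rw [mem_range] at hm; omega
    have hexp : cexp (((((m : ℝ) - k) * x : ℝ)) * I) = a ^ m * b ^ (2 * k - m) := by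
      rw [ha, hb, ← Complex.exp_nat_mul, ← Complex.exp_nat_mul, ← Complex.exp_add]
      congr 1
      rw [hw]
      push_cast [Nat.cast_sub hm']
      ring
    have hsign : ((-1 : ℂ) ^ (2 * k - m)) = (-1) ^ m := by
      have h1 : (-1 : ℂ) ^ (2 * k - m) * (-1) ^ m = 1 := by
        rw [← pow_add, Nat.sub_add_cancel hm', pow_mul]; simp
      have h2 : ((-1 : ℂ) ^ m) * (-1) ^ m = 1 := by rw [← pow_add, ← two_mul, pow_mul]; simp
      calc ((-1 : ℂ) ^ (2 * k - m)) = (-1) ^ (2 * k - m) * ((-1) ^ m * (-1) ^ m) := by rw [h2, mul_one]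
        _ = ((-1) ^ (2 * k - m) * (-1) ^ m) * (-1) ^ m := by ring
        _ = (-1) ^ m := by rw [h1, one_mul]
    rw [hexp, neg_pow b, hsign]
    ring
  rw [Finset.sum_congr rfl hterm, ← add_pow]
  have hab : a + -b = 2 * (Complex.sin w * I) := by rw [← cexp_sub_cexp_neg w, ha, hb]; ring
  rw [hab, hw, ← Complex.ofReal_sin]
  set s : ℝ := Real.sin (x / 2) with hs
  push_cast
  simp only [mul_pow, pow_mul, Complex.I_sq]
  ring

end Trig

section IntegralIdentity

open Complex MeasureTheory

theorem continuous_apply_E4 (i : Fin 4) : Continuous fun p : (EuclideanSpace ℝ (Fin 4)) => p i :=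
  (EuclideanSpace.proj i).continuous

/-- Under `μ {p₀ < 0} = 0`, almost every momentum has nonnegative energy. -/
theorem ae_energy_nonneg {μ : Measure (EuclideanSpace ℝ (Fin 4))} (hE : μ {p | p 0 < 0} = 0) : ∀ᵐ p ∂μ, 0 ≤ p 0 := by
  rw [ae_iff]
  simpa only [not_le] using hE

/-- The Laplace–Fourier integrand `e^{-tp₀ + ibp₁}` is integrable (finite measure carried by `{p₀ ≥ 0}`). -/
theorem integrable_cexp_section (μ : Measure (EuclideanSpace ℝ (Fin 4))) [IsFiniteMeasure μ] (hE : μ {p | p 0 < 0} = 0)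
    {t : ℝ} (ht : 0 ≤ t) (b : ℝ) :
    Integrable (fun p : (EuclideanSpace ℝ (Fin 4)) => cexp ((((-(t * p 0) : ℝ)) : ℂ) + ((b * p 1 : ℝ) : ℂ) * I)) μ := by
  refine Integrable.of_bound (by fun_prop) 1 ?_
  filter_upwards [ae_energy_nonneg hE] with p hp
  rw [Complex.norm_exp]
  simp only [Complex.add_re, Complex.ofReal_re, Complex.mul_re, Complex.I_re, mul_zero, Complex.ofReal_im,
    Complex.I_im, mul_one, sub_self, add_zero]
  rw [Real.exp_le_one_iff]
  nlinarith

/-- **The integral identity**: with `f` the section at level `t` (`f(b) = ∫ e^{-tp₀+ibp₁} dμ` for `|b| < t`)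
and `kh < t`, `∫ e^{-tp₀} (2 sin(hp₁/2))^{2k} dμ = (-1)^k Δ_h^{2k} f(0)`. -/
theorem integral_sinPow_eq_centralDiff (μ : Measure (EuclideanSpace ℝ (Fin 4))) [IsFiniteMeasure μ] (hE : μ {p | p 0 < 0} = 0)
    {t : ℝ} (ht : 0 < t) {f : ℂ → ℂ}
    (hfb : ∀ b : ℝ, |b| < t →
      f b = ∫ p, cexp ((((-(t * p 0) : ℝ)) : ℂ) + ((b * p 1 : ℝ) : ℂ) * I) ∂μ)
    (k : ℕ) {h : ℝ} (hh : 0 < h) (hkh : k * h < t) :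
    (((∫ p, Real.exp (-(t * p 0)) * (2 * Real.sin (h * p 1 / 2)) ^ (2 * k) ∂μ : ℝ)) : ℂ) =
      (-1) ^ k * centralDiff k h f := by
  -- the nodes are real with `|b_m| ≤ kh < t`
  have hnode_abs : ∀ m ∈ range (2 * k + 1), |((m : ℝ) - k) * h| < t := by
    intro m hm
    have := norm_node_le k hh.le hm
    rw [node, Complex.norm_real, Real.norm_eq_abs] at this
    exact lt_of_le_of_lt this hkh
  have hcd : centralDiff k h f = ∑ m ∈ range (2 * k + 1), (-1) ^ m * ((2 * k).choose m : ℂ) *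
      ∫ p, cexp ((((-(t * p 0) : ℝ)) : ℂ) + (((((m : ℝ) - k) * h) * p 1 : ℝ) : ℂ) * I) ∂μ := by
    unfold centralDiff
    refine Finset.sum_congr rfl fun m hm => ?_
    rw [node, hfb _ (hnode_abs m hm)]
  -- swap sum and integral
  have hint : ∀ m ∈ range (2 * k + 1), Integrable (fun p : (EuclideanSpace ℝ (Fin 4)) => (-1) ^ m * ((2 * k).choose m : ℂ) *
      cexp ((((-(t * p 0) : ℝ)) : ℂ) + (((((m : ℝ) - k) * h) * p 1 : ℝ) : ℂ) * I)) μ := fun m _ =>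
    (integrable_cexp_section μ hE ht.le _).const_mul _
  have hswap : centralDiff k h f = ∫ p, ∑ m ∈ range (2 * k + 1), (-1) ^ m * ((2 * k).choose m : ℂ) *
      cexp ((((-(t * p 0) : ℝ)) : ℂ) + (((((m : ℝ) - k) * h) * p 1 : ℝ) : ℂ) * I) ∂μ := by
    rw [integral_finsetSum _ hint, hcd]
    refine Finset.sum_congr rfl fun m _ => ?_
    rw [integral_const_mul]
  -- pointwise trigonometric identity
  have hpt : ∀ p : (EuclideanSpace ℝ (Fin 4)), ∑ m ∈ range (2 * k + 1), (-1) ^ m * ((2 * k).choose m : ℂ) *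
      cexp ((((-(t * p 0) : ℝ)) : ℂ) + (((((m : ℝ) - k) * h) * p 1 : ℝ) : ℂ) * I) =
      (-1) ^ k * (((Real.exp (-(t * p 0)) * (2 * Real.sin (h * p 1 / 2)) ^ (2 * k) : ℝ)) : ℂ) := by
    intro p
    have h1 : ∀ m ∈ range (2 * k + 1), (-1) ^ m * ((2 * k).choose m : ℂ) *
        cexp ((((-(t * p 0) : ℝ)) : ℂ) + (((((m : ℝ) - k) * h) * p 1 : ℝ) : ℂ) * I) =
        cexp (((-(t * p 0) : ℝ) : ℂ)) * ((-1) ^ m * ((2 * k).choose m : ℂ) *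
          cexp (((((m : ℝ) - k) * (h * p 1) : ℝ)) * I)) := by
      intro m _
      rw [Complex.exp_add]
      have : (((((m : ℝ) - k) * h) * p 1 : ℝ) : ℂ) = ((((m : ℝ) - k) * (h * p 1) : ℝ) : ℂ) := by
        push_cast; ring
      rw [this]; ring
    rw [Finset.sum_congr rfl h1, ← Finset.mul_sum, sum_centralCoeff_cexp k (h * p 1)]
    push_cast
    ring
  rw [hswap]
  simp_rw [hpt]
  rw [integral_const_mul, integral_complex_ofReal, ← mul_assoc, ← pow_add, ← two_mul, pow_mul]
  simp

end IntegralIdentity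


/-! ## Part D: even moments of the damped measure from the disc bound (Fatou) -/

section Moments

open Complex MeasureTheory Filter Topology Metric

/-- `y · sinc(hy/2) = 2 sin(hy/2)/h` for `h ≠ 0`. -/
theorem mul_sinc_eq (h y : ℝ) (hh : h ≠ 0) : y * Real.sinc (h * y / 2) = 2 * Real.sin (h * y / 2) / h := by
  by_cases hy : y = 0
  · simp [hy]
  · have hne : h * y / 2 ≠ 0 := div_ne_zero (mul_ne_zero hh hy) two_ne_zero
    rw [Real.sinc_of_ne_zero hne]
    field_simp

/-- `|y · sinc(hy/2)| ≤ 2/|h|`. -/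
theorem abs_mul_sinc_le (h y : ℝ) (hh : h ≠ 0) : |y * Real.sinc (h * y / 2)| ≤ 2 / |h| := by
  rw [mul_sinc_eq h y hh, abs_div, abs_mul, abs_two]
  gcongr
  have := Real.abs_sin_le_one (h * y / 2)
  linarith

/-- The regularised moment integrand `G_h(p) = e^{-tp₀} (p₁ sinc(hp₁/2))^{2k}`. -/
def momG (t : ℝ) (k : ℕ) (h : ℝ) (p : (EuclideanSpace ℝ (Fin 4))) : ℝ :=
  Real.exp (-(t * p 0)) * (p 1 * Real.sinc (h * p 1 / 2)) ^ (2 * k)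

theorem continuous_momG (t : ℝ) (k : ℕ) (h : ℝ) : Continuous (momG t k h) := by
  unfold momG
  have h0 := continuous_apply_E4 0
  have h1 := continuous_apply_E4 1
  refine ((Real.continuous_exp.comp (h0.const_mul t).neg)).mul ?_
  exact (h1.mul (Real.continuous_sinc.comp ((h1.const_mul h).div_const 2))).pow _

theorem momG_nonneg (t : ℝ) (k : ℕ) (h : ℝ) (p : (EuclideanSpace ℝ (Fin 4))) : 0 ≤ momG t k h p :=
  mul_nonneg (Real.exp_pos _).le (Even.pow_nonneg (even_two_mul k) _)

/-- For `h ≠ 0`: `G_h(p) = h^{-2k} · e^{-tp₀} (2 sin(hp₁/2))^{2k}`. -/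
theorem momG_eq (t : ℝ) (k : ℕ) {h : ℝ} (hh : h ≠ 0) (p : (EuclideanSpace ℝ (Fin 4))) :
    momG t k h p = (h ^ (2 * k))⁻¹ * (Real.exp (-(t * p 0)) * (2 * Real.sin (h * p 1 / 2)) ^ (2 * k)) := by
  rw [momG, mul_sinc_eq h _ hh, div_pow]
  ring

/-- At `h = 0`: `G_0(p) = e^{-tp₀} p₁^{2k}`. -/
theorem momG_zero (t : ℝ) (k : ℕ) (p : (EuclideanSpace ℝ (Fin 4))) : momG t k 0 p = Real.exp (-(t * p 0)) * p 1 ^ (2 * k) := by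
  simp [momG]

/-- `h ↦ G_h(p)` is continuous (through `h = 0`). -/
theorem continuous_momG_param (t : ℝ) (k : ℕ) (p : (EuclideanSpace ℝ (Fin 4))) : Continuous fun h : ℝ => momG t k h p := by
  unfold momG
  refine continuous_const.mul ((continuous_const.mul (Real.continuous_sinc.comp ?_)).pow _)
  exact (continuous_id.mul continuous_const).div_const 2

/-- `G_h` is integrable (finite measure, `p₀ ≥ 0` a.e., `|p₁ sinc| ≤ 2/h`). -/
theorem integrable_momG (μ : Measure (EuclideanSpace ℝ (Fin 4))) [IsFiniteMeasure μ] (hE : μ {p | p 0 < 0} = 0)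
    {t : ℝ} (ht : 0 ≤ t) (k : ℕ) {h : ℝ} (hh : h ≠ 0) : Integrable (momG t k h) μ := by
  refine Integrable.of_bound (continuous_momG t k h).aestronglyMeasurable ((2 / |h|) ^ (2 * k)) ?_
  filter_upwards [ae_energy_nonneg hE] with p hp
  rw [Real.norm_eq_abs, abs_of_nonneg (momG_nonneg t k h p), momG]
  have he : Real.exp (-(t * p 0)) ≤ 1 := by
    rw [Real.exp_le_one_iff]; nlinarith
  have hp : (p 1 * Real.sinc (h * p 1 / 2)) ^ (2 * k) ≤ (2 / |h|) ^ (2 * k) := by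
    calc (p 1 * Real.sinc (h * p 1 / 2)) ^ (2 * k) = |p 1 * Real.sinc (h * p 1 / 2)| ^ (2 * k) := by
          rw [← abs_pow, abs_of_nonneg (Even.pow_nonneg (even_two_mul k) _)]
      _ ≤ (2 / |h|) ^ (2 * k) := pow_le_pow_left₀ (abs_nonneg _) (abs_mul_sinc_le h _ hh) _
  calc Real.exp (-(t * p 0)) * (p 1 * Real.sinc (h * p 1 / 2)) ^ (2 * k)
      ≤ 1 * (2 / |h|) ^ (2 * k) := mul_le_mul he hp (Even.pow_nonneg (even_two_mul k) _) zero_le_one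
    _ = (2 / |h|) ^ (2 * k) := one_mul _

/-- **The regularised moments are bounded by the disc data**: for `0 < h`, `kh < r < t`,
`∫ G_h dμ ≤ (2k)! · r M/(r-kh)^{2k+1}`. -/
theorem integral_momG_le (μ : Measure (EuclideanSpace ℝ (Fin 4))) [IsFiniteMeasure μ] (hE : μ {p | p 0 < 0} = 0) (M : ℝ)
    {t : ℝ} (ht : 0 < t) {f : ℂ → ℂ} (hfd : DifferentiableOn ℂ f (ball (0 : ℂ) t))
    (hfM : ∀ z ∈ ball (0 : ℂ) t, ‖f z‖ ≤ M)
    (hfb : ∀ b : ℝ, |b| < t →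
      f b = ∫ p, cexp ((((-(t * p 0) : ℝ)) : ℂ) + ((b * p 1 : ℝ) : ℂ) * I) ∂μ)
    (k : ℕ) {h r : ℝ} (hh : 0 < h) (hkr : k * h < r) (hrt : r < t) :
    ∫ p, momG t k h p ∂μ ≤ (2 * k).factorial * (r * (M / (r - k * h) ^ (2 * k + 1))) := by
  have hkh : k * h < t := hkr.trans hrt
  have e1 : ∫ p, momG t k h p ∂μ =
      (h ^ (2 * k))⁻¹ * ∫ p, Real.exp (-(t * p 0)) * (2 * Real.sin (h * p 1 / 2)) ^ (2 * k) ∂μ := by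
    rw [← integral_const_mul]
    exact integral_congr_ae (Eventually.of_forall fun p => momG_eq t k hh.ne' p)
  have e2 : (∫ p, Real.exp (-(t * p 0)) * (2 * Real.sin (h * p 1 / 2)) ^ (2 * k) ∂μ) =
      ((-1 : ℂ) ^ k * centralDiff k h f).re := by
    rw [← integral_sinPow_eq_centralDiff μ hE ht hfb k hh hkh, Complex.ofReal_re]
  have e3 : ((-1 : ℂ) ^ k * centralDiff k h f).re ≤ ‖centralDiff k h f‖ := by
    refine (Complex.re_le_norm _).trans ?_
    rw [norm_mul, norm_pow, norm_neg, norm_one, one_pow, one_mul]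
  have e4 := norm_centralDiff_le k hfd hfM hh hkr hrt
  have hhk : 0 < h ^ (2 * k) := pow_pos hh _
  rw [e1, e2]
  calc (h ^ (2 * k))⁻¹ * ((-1 : ℂ) ^ k * centralDiff k h f).re
      ≤ (h ^ (2 * k))⁻¹ * ((2 * k).factorial * h ^ (2 * k) * (r * (M / (r - k * h) ^ (2 * k + 1)))) :=
        mul_le_mul_of_nonneg_left (e3.trans e4) (inv_nonneg.2 hhk.le)
    _ = (2 * k).factorial * (r * (M / (r - k * h) ^ (2 * k + 1))) := by
        field_simp

/-- **Even moments of the damped measure** (Fatou along `h → 0⁺`, then `r → t⁻`):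
`∫⁻ e^{-tp₀} p₁^{2k} dμ ≤ (2k)! M / t^{2k}`. -/
theorem lintegral_moment_le (μ : Measure (EuclideanSpace ℝ (Fin 4))) [IsFiniteMeasure μ] (hE : μ {p | p 0 < 0} = 0) (M : ℝ)
    {t : ℝ} (ht : 0 < t) {f : ℂ → ℂ} (hfd : DifferentiableOn ℂ f (ball (0 : ℂ) t))
    (hfM : ∀ z ∈ ball (0 : ℂ) t, ‖f z‖ ≤ M)
    (hfb : ∀ b : ℝ, |b| < t →
      f b = ∫ p, cexp ((((-(t * p 0) : ℝ)) : ℂ) + ((b * p 1 : ℝ) : ℂ) * I) ∂μ)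
    (k : ℕ) :
    ∫⁻ p, ENNReal.ofReal (Real.exp (-(t * p 0)) * p 1 ^ (2 * k)) ∂μ ≤
      ENNReal.ofReal ((2 * k).factorial * (M / t ^ (2 * k))) := by
  -- Step 1: the bound at every intermediate radius `r < t`
  have hr_bound : ∀ r : ℝ, 0 < r → r < t →
      ∫⁻ p, ENNReal.ofReal (Real.exp (-(t * p 0)) * p 1 ^ (2 * k)) ∂μ ≤
        ENNReal.ofReal ((2 * k).factorial * (r * (M / r ^ (2 * k + 1)))) := by
    intro r hr hrt
    -- the sequence h_n = r / ((k+1)(n+1)) : positive, k h_n < r, h_n → 0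
    set hs : ℕ → ℝ := fun n => r / ((k + 1 : ℝ) * (n + 1)) with hhs
    have hs_pos : ∀ n, 0 < hs n := fun n => by positivity
    have hs_k : ∀ n, k * hs n < r := by
      intro n
      simp only [hhs]
      rw [mul_div_assoc', div_lt_iff₀ (by positivity)]
      have h1 : (k : ℝ) < (k + 1) * (n + 1) := by
        have : (0 : ℝ) ≤ n := Nat.cast_nonneg n
        nlinarith
      nlinarith
    have hs_lim : Tendsto hs atTop (𝓝 0) := by
      simp only [hhs]
      have h1 : Tendsto (fun n : ℕ => ((k + 1 : ℝ) * (n + 1))) atTop atTop := by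
        refine Tendsto.const_mul_atTop (by positivity) ?_
        exact tendsto_atTop_add_const_right _ 1 tendsto_natCast_atTop_atTop
      exact tendsto_const_nhds.div_atTop h1
    -- Fatou
    set F : ℕ → (EuclideanSpace ℝ (Fin 4)) → ENNReal := fun n p => ENNReal.ofReal (momG t k (hs n) p) with hF
    have hF_meas : ∀ n, AEMeasurable (F n) μ := fun n =>
      (ENNReal.measurable_ofReal.comp (continuous_momG t k (hs n)).measurable).aemeasurable
    have hF_lim : ∀ p, Tendsto (fun n => F n p) atTop
        (𝓝 (ENNReal.ofReal (Real.exp (-(t * p 0)) * p 1 ^ (2 * k)))) := by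
      intro p
      rw [← momG_zero t k p]
      refine (ENNReal.continuous_ofReal.tendsto _).comp ?_
      exact ((continuous_momG_param t k p).tendsto 0).comp hs_lim
    have hfatou := lintegral_liminf_le' (μ := μ) (f := F) (u := atTop) hF_meas
    have hlim_eq : ∀ p, liminf (fun n => F n p) atTop = ENNReal.ofReal (Real.exp (-(t * p 0)) * p 1 ^ (2 * k)) :=
      fun p => (hF_lim p).liminf_eq
    simp_rw [hlim_eq] at hfatou
    refine hfatou.trans ?_
    -- each `∫⁻ F n ≤ B n`, and `B n → (2k)! r M / r^{2k+1}`
    set B : ℕ → ℝ := fun n => (2 * k).factorial * (r * (M / (r - k * hs n) ^ (2 * k + 1))) with hB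
    have hFB : ∀ n, ∫⁻ p, F n p ∂μ ≤ ENNReal.ofReal (B n) := by
      intro n
      simp only [hF]
      rw [← ofReal_integral_eq_lintegral_ofReal (integrable_momG μ hE ht.le k (hs_pos n).ne')
        (Eventually.of_forall (momG_nonneg t k (hs n)))]
      exact ENNReal.ofReal_le_ofReal (integral_momG_le μ hE M ht hfd hfM hfb k (hs_pos n) (hs_k n) hrt)
    have hB_lim : Tendsto (fun n => ENNReal.ofReal (B n)) atTop
        (𝓝 (ENNReal.ofReal ((2 * k).factorial * (r * (M / r ^ (2 * k + 1)))))) := by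
      refine ENNReal.tendsto_ofReal (Tendsto.const_mul _ (Tendsto.const_mul _ (Tendsto.div tendsto_const_nhds ?_ ?_)))
      · have : Tendsto (fun n => r - k * hs n) atTop (𝓝 (r - k * 0)) :=
          tendsto_const_nhds.sub (hs_lim.const_mul _)
        rw [mul_zero, sub_zero] at this
        exact this.pow _
      · exact pow_ne_zero _ hr.ne'
    calc liminf (fun n => ∫⁻ p, F n p ∂μ) atTop ≤ liminf (fun n => ENNReal.ofReal (B n)) atTop :=
          liminf_le_liminf (Eventually.of_forall hFB)
      _ = ENNReal.ofReal ((2 * k).factorial * (r * (M / r ^ (2 * k + 1)))) := hB_lim.liminf_eq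
  -- Step 2: `r → t⁻` along `r_n = t (n+1)/(n+2)`
  set rs : ℕ → ℝ := fun n => t * ((((n + 1 : ℕ) : ℝ)) / (((n + 1 : ℕ) : ℝ) + 1)) with hrs
  have rs_pos : ∀ n, 0 < rs n := fun n => by positivity
  have rs_lt : ∀ n, rs n < t := by
    intro n
    have h1 : (((n + 1 : ℕ) : ℝ)) / (((n + 1 : ℕ) : ℝ) + 1) < 1 := by
      rw [div_lt_one (by positivity)]; linarith
    calc rs n = t * ((((n + 1 : ℕ) : ℝ)) / (((n + 1 : ℕ) : ℝ) + 1)) := rfl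
      _ < t * 1 := mul_lt_mul_of_pos_left h1 ht
      _ = t := mul_one t
  have rs_lim : Tendsto rs atTop (𝓝 t) := by
    have h1 : Tendsto (fun n : ℕ => (((n + 1 : ℕ) : ℝ)) / (((n + 1 : ℕ) : ℝ) + 1)) atTop (𝓝 1) :=
      (tendsto_natCast_div_add_atTop (1 : ℝ)).comp (tendsto_add_atTop_nat 1)
    rw [hrs]
    simpa using h1.const_mul t
  have hB2 : Tendsto (fun n => ENNReal.ofReal ((2 * k).factorial * (rs n * (M / rs n ^ (2 * k + 1))))) atTop
      (𝓝 (ENNReal.ofReal ((2 * k).factorial * (t * (M / t ^ (2 * k + 1)))))) :=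
    ENNReal.tendsto_ofReal (tendsto_const_nhds.mul (rs_lim.mul
      (tendsto_const_nhds.div (rs_lim.pow _) (pow_ne_zero _ ht.ne'))))
  have hmain := ge_of_tendsto' hB2 fun n => hr_bound (rs n) (rs_pos n) (rs_lt n)
  have heq : (2 * k).factorial * (t * (M / t ^ (2 * k + 1))) = (2 * k).factorial * (M / t ^ (2 * k)) := by
    rw [pow_succ]; field_simp
  rwa [heq] at hmain

end Moments


/-! ## Part E: the `κ`-uniform exponential bound (cosh series; no strip, no identity theorem) -/

section ExpBound

open Complex MeasureTheory Filter Topology Metric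

theorem exp_abs_le_two_cosh (x : ℝ) : Real.exp |x| ≤ 2 * Real.cosh x := by
  rw [Real.cosh_eq]
  rcases le_total 0 x with hx | hx
  · rw [abs_of_nonneg hx]; have := Real.exp_pos (-x); linarith
  · rw [abs_of_nonpos hx]; have := Real.exp_pos x; linarith

/-- **`∫⁻ e^{-tp₀ + κt|p₁|} dμ ≤ 2M/(1-κ²)` for `0 ≤ κ < 1`, uniformly in `t`.** -/
theorem lintegral_exp_le (μ : Measure (EuclideanSpace ℝ (Fin 4))) [IsFiniteMeasure μ] (hE : μ {p | p 0 < 0} = 0) (M : ℝ)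
    {t : ℝ} (ht : 0 < t) {f : ℂ → ℂ} (hfd : DifferentiableOn ℂ f (ball (0 : ℂ) t))
    (hfM : ∀ z ∈ ball (0 : ℂ) t, ‖f z‖ ≤ M)
    (hfb : ∀ b : ℝ, |b| < t →
      f b = ∫ p, cexp ((((-(t * p 0) : ℝ)) : ℂ) + ((b * p 1 : ℝ) : ℂ) * I) ∂μ)
    {κ : ℝ} (hκ0 : 0 ≤ κ) (hκ1 : κ < 1) :
    ∫⁻ p, ENNReal.ofReal (Real.exp (-(t * p 0) + κ * t * |p 1|)) ∂μ ≤ ENNReal.ofReal (2 * M / (1 - κ ^ 2)) := by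
  have hM : 0 ≤ M := (norm_nonneg _).trans (hfM 0 (Metric.mem_ball_self ht))
  -- the summands `c_n · e^{-tp₀} p₁^{2n}`, `c_n = 2 (κt)^{2n}/(2n)!`
  set c : ℕ → ℝ := fun n => 2 * (κ * t) ^ (2 * n) / (2 * n).factorial with hc
  have hc0 : ∀ n, 0 ≤ c n := fun n => by
    have := Even.pow_nonneg (even_two_mul n) (κ * t); positivity
  set g : ℕ → (EuclideanSpace ℝ (Fin 4)) → ℝ := fun n p => Real.exp (-(t * p 0)) * p 1 ^ (2 * n) with hg
  have hg0 : ∀ n p, 0 ≤ g n p := fun n p => mul_nonneg (Real.exp_pos _).le (Even.pow_nonneg (even_two_mul n) _)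
  have hg_meas : ∀ n, Measurable (g n) := fun n => by
    simp only [hg]
    exact ((Real.continuous_exp.comp ((continuous_apply_E4 0).const_mul t).neg).mul
      ((continuous_apply_E4 1).pow _)).measurable
  -- pointwise series bound
  have hpt : ∀ p : (EuclideanSpace ℝ (Fin 4)), ENNReal.ofReal (Real.exp (-(t * p 0) + κ * t * |p 1|)) ≤
      ∑' n : ℕ, ENNReal.ofReal (c n * g n p) := by
    intro p
    have hsum : HasSum (fun n : ℕ => (κ * t * p 1) ^ (2 * n) / (2 * n).factorial) (Real.cosh (κ * t * p 1)) :=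
      Real.hasSum_cosh _
    have hnn : ∀ n : ℕ, 0 ≤ c n * g n p := fun n => mul_nonneg (hc0 n) (hg0 n p)
    have hsum2 : HasSum (fun n : ℕ => c n * g n p) (2 * Real.exp (-(t * p 0)) * Real.cosh (κ * t * p 1)) := by
      have h3 : (fun n : ℕ => c n * g n p) =
          fun n => 2 * Real.exp (-(t * p 0)) * ((κ * t * p 1) ^ (2 * n) / (2 * n).factorial) := by
        funext n
        show 2 * (κ * t) ^ (2 * n) / (2 * n).factorial * (Real.exp (-(t * p 0)) * p 1 ^ (2 * n)) = _
        rw [mul_pow]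
        ring
      rw [h3]
      exact hsum.mul_left _
    rw [← ENNReal.ofReal_tsum_of_nonneg hnn hsum2.summable, hsum2.tsum_eq]
    refine ENNReal.ofReal_le_ofReal ?_
    rw [Real.exp_add]
    have h1 : Real.exp (κ * t * |p 1|) ≤ 2 * Real.cosh (κ * t * p 1) := by
      have : κ * t * |p 1| = |κ * t * p 1| := by
        rw [abs_mul, abs_of_nonneg (by positivity : 0 ≤ κ * t)]
      rw [this]
      exact exp_abs_le_two_cosh _
    calc Real.exp (-(t * p 0)) * Real.exp (κ * t * |p 1|)
        ≤ Real.exp (-(t * p 0)) * (2 * Real.cosh (κ * t * p 1)) :=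
          mul_le_mul_of_nonneg_left h1 (Real.exp_pos _).le
      _ = 2 * Real.exp (-(t * p 0)) * Real.cosh (κ * t * p 1) := by ring
  -- termwise integration against the moment bound
  have hterm : ∀ n : ℕ, ∫⁻ p, ENNReal.ofReal (c n * g n p) ∂μ ≤ ENNReal.ofReal (2 * M * (κ ^ 2) ^ n) := by
    intro n
    have e1 : ∫⁻ p, ENNReal.ofReal (c n * g n p) ∂μ = ENNReal.ofReal (c n) * ∫⁻ p, ENNReal.ofReal (g n p) ∂μ := by
      rw [← lintegral_const_mul _ (hg_meas n).ennreal_ofReal]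
      refine lintegral_congr fun p => ?_
      rw [ENNReal.ofReal_mul (hc0 n)]
    have e2 := lintegral_moment_le μ hE M ht hfd hfM hfb n
    rw [e1]
    calc ENNReal.ofReal (c n) * ∫⁻ p, ENNReal.ofReal (g n p) ∂μ
        ≤ ENNReal.ofReal (c n) * ENNReal.ofReal ((2 * n).factorial * (M / t ^ (2 * n))) := by
          gcongr
      _ = ENNReal.ofReal (c n * ((2 * n).factorial * (M / t ^ (2 * n)))) := (ENNReal.ofReal_mul (hc0 n)).symm
      _ = ENNReal.ofReal (2 * M * (κ ^ 2) ^ n) := by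
          congr 1
          simp only [hc]
          have hfac : ((2 * n).factorial : ℝ) ≠ 0 := by exact_mod_cast (Nat.factorial_pos _).ne'
          have htn : t ^ (2 * n) ≠ 0 := pow_ne_zero _ ht.ne'
          rw [← pow_mul, mul_pow]
          field_simp
  have hκ2 : κ ^ 2 < 1 := by nlinarith
  have hgeo : HasSum (fun n : ℕ => 2 * M * (κ ^ 2) ^ n) (2 * M * (1 - κ ^ 2)⁻¹) :=
    (hasSum_geometric_of_lt_one (sq_nonneg κ) hκ2).mul_left (2 * M)
  calc ∫⁻ p, ENNReal.ofReal (Real.exp (-(t * p 0) + κ * t * |p 1|)) ∂μ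
      ≤ ∫⁻ p, ∑' n : ℕ, ENNReal.ofReal (c n * g n p) ∂μ := lintegral_mono hpt
    _ = ∑' n : ℕ, ∫⁻ p, ENNReal.ofReal (c n * g n p) ∂μ :=
        lintegral_tsum fun n => (ENNReal.measurable_ofReal.comp ((hg_meas n).const_mul (c n))).aemeasurable
    _ ≤ ∑' n : ℕ, ENNReal.ofReal (2 * M * (κ ^ 2) ^ n) := ENNReal.tsum_le_tsum hterm
    _ = ENNReal.ofReal (∑' n : ℕ, 2 * M * (κ ^ 2) ^ n) :=
        (ENNReal.ofReal_tsum_of_nonneg (fun n => by positivity) hgeo.summable).symm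
    _ = ENNReal.ofReal (2 * M / (1 - κ ^ 2)) := by rw [hgeo.tsum_eq, div_eq_mul_inv]

end ExpBound

/-! ## Part F: rays, and the lever itself -/

section Rays

open Complex MeasureTheory Filter Topology Metric Set

/-- Chebyshev in exponential form: if `c ≤ g` on `B` and `∫⁻ e^{g} ≤ C` then `μ B ≤ C e^{−c}`. -/
theorem measure_le_of_lintegral_exp_le {μ : Measure (EuclideanSpace ℝ (Fin 4))} {g : (EuclideanSpace ℝ (Fin 4)) → ℝ} {B : Set (EuclideanSpace ℝ (Fin 4))}
    (hB : MeasurableSet B) {c C : ℝ} (hcB : ∀ p ∈ B, c ≤ g p)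
    (hint : ∫⁻ p, ENNReal.ofReal (Real.exp (g p)) ∂μ ≤ ENNReal.ofReal C) :
    μ B ≤ ENNReal.ofReal (C * Real.exp (-c)) := by
  have h1 : ENNReal.ofReal (Real.exp c) * μ B ≤ ENNReal.ofReal C := by
    calc ENNReal.ofReal (Real.exp c) * μ B
        = ∫⁻ _ in B, ENNReal.ofReal (Real.exp c) ∂μ := by rw [setLIntegral_const]
      _ ≤ ∫⁻ p in B, ENNReal.ofReal (Real.exp (g p)) ∂μ :=
          setLIntegral_mono' hB fun p hp => ENNReal.ofReal_le_ofReal (Real.exp_le_exp.2 (hcB p hp))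
      _ ≤ ∫⁻ p, ENNReal.ofReal (Real.exp (g p)) ∂μ := setLIntegral_le_lintegral _ _
      _ ≤ ENNReal.ofReal C := hint
  have hc : ENNReal.ofReal (Real.exp c) ≠ 0 := by
    rw [Ne, ENNReal.ofReal_eq_zero, not_le]
    exact Real.exp_pos c
  calc μ B = (ENNReal.ofReal (Real.exp c))⁻¹ * (ENNReal.ofReal (Real.exp c) * μ B) := by
        rw [← mul_assoc, ENNReal.inv_mul_cancel hc ENNReal.ofReal_ne_top, one_mul]
    _ ≤ (ENNReal.ofReal (Real.exp c))⁻¹ * ENNReal.ofReal C := by gcongr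
    _ = ENNReal.ofReal (C * Real.exp (-c)) := by
        rw [← ENNReal.ofReal_inv_of_pos (Real.exp_pos c),
          ← ENNReal.ofReal_mul (inv_nonneg.2 (Real.exp_pos c).le), Real.exp_neg, mul_comm]

/-- A quantity bounded by `C e^{−tδ}` for all `t > 0` (`δ > 0`) vanishes. -/
theorem eq_zero_of_forall_le_exp {a : ENNReal} {C δ : ℝ} (hδ : 0 < δ)
    (h : ∀ t : ℝ, 0 < t → a ≤ ENNReal.ofReal (C * Real.exp (-(t * δ)))) : a = 0 := by
  have hlim : Tendsto (fun t : ℝ => ENNReal.ofReal (C * Real.exp (-(t * δ)))) atTop (𝓝 0) := by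
    have h1 : Tendsto (fun t : ℝ => Real.exp (-(t * δ))) atTop (𝓝 0) :=
      Real.tendsto_exp_neg_atTop_nhds_zero.comp (tendsto_id.atTop_mul_const hδ)
    have h2 : Tendsto (fun t : ℝ => C * Real.exp (-(t * δ))) atTop (𝓝 0) := by
      simpa using h1.const_mul C
    simpa using ENNReal.tendsto_ofReal h2
  refine le_antisymm (ge_of_tendsto hlim ?_) bot_le
  exact Filter.eventually_atTop.2 ⟨1, fun t ht => h t (by linarith)⟩

/-- The wedge piece `{δ < κ |p₁| − p₀}`. -/
def wedgePiece (κ δ : ℚ) : Set (EuclideanSpace ℝ (Fin 4)) := {p | (δ : ℝ) < κ * |p 1| - p 0}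

theorem measurableSet_wedgePiece (κ δ : ℚ) : MeasurableSet (wedgePiece κ δ) :=
  measurableSet_lt measurable_const
    ((measurable_const.mul (continuous_apply_E4 1).measurable.abs).sub (continuous_apply_E4 0).measurable)

/-- Each wedge piece is null under a `κ`-uniform exponential bound. -/
theorem measure_wedgePiece_eq_zero {μ : Measure (EuclideanSpace ℝ (Fin 4))} {κ δ : ℚ} {C : ℝ} (hδ : 0 < (δ : ℝ))
    (hL : ∀ t : ℝ, 0 < t →
      ∫⁻ p, ENNReal.ofReal (Real.exp (-(t * p 0) + κ * t * |p 1|)) ∂μ ≤ ENNReal.ofReal C) :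
    μ (wedgePiece κ δ) = 0 := by
  refine eq_zero_of_forall_le_exp (C := C) hδ fun t ht => ?_
  refine measure_le_of_lintegral_exp_le (measurableSet_wedgePiece κ δ) (fun p hp => ?_) (hL t ht)
  have hp' : (δ : ℝ) < κ * |p 1| - p 0 := hp
  have : t * δ ≤ t * (κ * |p 1| - p 0) := mul_le_mul_of_nonneg_left hp'.le ht.le
  linarith

/-- **Rays.** A `κ`-uniform (in `t`) bound on `∫⁻ e^{−tp₀ + κt|p₁|} dμ` for every `κ ∈ [0,1)` forces `μ`
onto the closed cone `{p₀ ≥ |p₁|}`. -/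
theorem cone_of_exp_bounds (μ : Measure (EuclideanSpace ℝ (Fin 4)))
    (hL : ∀ κ : ℝ, 0 ≤ κ → κ < 1 → ∃ C : ℝ, ∀ t : ℝ, 0 < t →
      ∫⁻ p, ENNReal.ofReal (Real.exp (-(t * p 0) + κ * t * |p 1|)) ∂μ ≤ ENNReal.ofReal C) :
    μ {p | p 0 < |p 1|} = 0 := by
  classical
  have hcover : {p : (EuclideanSpace ℝ (Fin 4)) | p 0 < |p 1|} ⊆
      ⋃ q : ℚ × ℚ, if (0 : ℝ) ≤ q.1 ∧ (q.1 : ℝ) < 1 ∧ 0 < (q.2 : ℝ) then wedgePiece q.1 q.2 else ∅ := by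
    intro p hp
    have hp : p 0 < |p 1| := hp
    -- a rational slope κ ∈ [0,1) with κ |p₁| > p₀
    obtain ⟨κ, hκ0, hκ1, hκ2⟩ : ∃ κ : ℚ, (0 : ℝ) ≤ κ ∧ (κ : ℝ) < 1 ∧ p 0 < κ * |p 1| := by
      rcases lt_or_ge (p 0) 0 with h0 | h0
      · refine ⟨0, by norm_num, by norm_num, ?_⟩
        simpa using h0
      · have h1 : 0 < |p 1| := lt_of_le_of_lt h0 hp
        have hq : p 0 / |p 1| < 1 := by rw [div_lt_one h1]; exact hp
        obtain ⟨κ, hκa, hκb⟩ := exists_rat_btwn hq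
        refine ⟨κ, ?_, hκb, ?_⟩
        · exact le_trans (div_nonneg h0 h1.le) hκa.le
        · rw [div_lt_iff₀ h1] at hκa; linarith
    obtain ⟨δ, hδa, hδb⟩ := exists_rat_btwn (sub_pos.2 hκ2)
    refine mem_iUnion.2 ⟨(κ, δ), ?_⟩
    show p ∈ (if (0 : ℝ) ≤ κ ∧ (κ : ℝ) < 1 ∧ 0 < (δ : ℝ) then wedgePiece κ δ else ∅)
    rw [if_pos ⟨hκ0, hκ1, hδa⟩]
    exact hδb
  refine measure_mono_null hcover (measure_iUnion_null fun q => ?_)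
  split_ifs with hq
  · obtain ⟨C, hC⟩ := hL q.1 hq.1 hq.2.1
    exact measure_wedgePiece_eq_zero hq.2.2 hC
  · exact measure_empty

/-- **The lever `stub_cone_of_discSections`, sorry-free** (signature verbatim from the lead's skeleton
`Lines/two-mirror-lightcone-slots.lean`, sha fe3e5eda): disc sections of radius `t` with a `t`-uniform bound
force `μ{p₀ < |p₁|} = 0`. Route: contour formula for central differences (Part B) ⇒ even moments of the
damped measure `≤ (2k)! M/t^{2k}` by Fatou (Part D) ⇒ `∫⁻ e^{-tp₀+κt|p₁|} ≤ 2M/(1-κ²)` by the cosh series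
(Part E) ⇒ rays (Part F). -/
theorem stub_cone_of_discSections (μ : Measure (EuclideanSpace ℝ (Fin 4))) [IsFiniteMeasure μ]
    (hE : μ {p | p 0 < 0} = 0) (M : ℝ)
    (hdisc : ∀ t : ℝ, 0 < t → ∃ f : ℂ → ℂ,
      DifferentiableOn ℂ f (Metric.ball 0 t) ∧
        (∀ z ∈ Metric.ball (0 : ℂ) t, ‖f z‖ ≤ M) ∧
          ∀ b : ℝ, |b| < t →
            f b = ∫ p, Complex.exp ((((-(t * p 0) : ℝ)) : ℂ) + ((b * p 1 : ℝ) : ℂ) * Complex.I) ∂μ) :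
    μ {p | p 0 < |p 1|} = 0 := by
  refine cone_of_exp_bounds μ fun κ hκ0 hκ1 => ⟨2 * M / (1 - κ ^ 2), fun t ht => ?_⟩
  obtain ⟨f, hfd, hfM, hfb⟩ := hdisc t ht
  exact lintegral_exp_le μ hE M ht hfd hfM hfb hκ0 hκ1

end Rays

end DrefuteG3
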